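import Mathlib.LinearAlgebra.RootSystem.Base
import Mathlib.LinearAlgebra.RootSystem.Hom
import Literature.NumberTheory.Automorphic.LinearAlgebraicGroups
import Literature.NumberTheory.Automorphic.RootData
import Literature.NumberTheory.Automorphic.LParameter
import Literature.NumberTheory.GaloisRepresentations.AbsGaloisGroup
import HarnessLib

-- provenance: harness21/H21/H21/Prelude/AutomorphicL/DualGroup.lean @ 4a3ae09 (interim HEAD d8f2665); M5 mechanical rewrite
open scoped IsMulCommutative

/-!
# The dual group as an L-group with based root datum (trunk T-AUTOMORPHIC, G25 AutomorphicL, item I3)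

Item G19 (`Literature.Prelude.AutomorphicAxiomatic.LParameter`) made the L-group a *linear* complex
group `L.dual ≤ GL_N(ℂ)` with a Galois action `L.galAct` (`LGroupData F`), without recording
why `L.dual` deserves the name "dual group". This file supplies that vocabulary (notion
`dual_group_L_group`, OUTLINE D1/I3): given a based root datum `(P, b)` (MATHLIB's
`RootPairing ι ℤ X Y` and `RootPairing.Base`; think of the based root datum
`Ψ₀(G) = (X*(T), Δ, X_*(T), Δ^∨)` of a connected reductive `G/F`), a

* `LGroupData.DualGroupStr L P b`

is a hypothesis-structure recording a maximal torus and a Borel subgroup `T̂ ≤ B̂ ≤ Ĝ = L.dual`,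
identifications `X*(T̂) ≃ Y`, `X_*(T̂) ≃ X` making `(P.flip, b.flip)` (Mathlib's dual based root
datum) the based root datum of `(Ĝ, B̂, T̂)` in the sense of item I2 (`IsBasedRootDatumOf`), a
pinning (`Pinning`), and a continuous action `galRoot : Γ_F → Aut(P, b)` (`basedAutGroup`) of the
absolute Galois group on the based root datum with which `L.galAct` is compatible on `T̂`, `B̂`,
characters and the pinning (Borel, *Automorphic L-functions*, Corvallis 1979, §§1.2, 2.1–2.4;
Springer, *Linear Algebraic Groups*, 9.6.2, 16.3). Then:

* `IsSplitDual D` (the predicate "trivial Galois action on the root datum", with `isSplitDual_iff`,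
  `isSplitDual_of_subsingleton`) and the named fact `IsSplitDual.isSplit`;
* `RootPairing.Base.twoRho b : X`, the sum `2ρ` of the `b`-positive roots (deliberate
  dot-notation extension of Mathlib's `RootPairing.Base`, using Mathlib's `RootPairing.Base.IsPos`);
* `twoRhoCochar D : ℂˣ →* T̂` (`2ρ ∈ X = X_*(T̂)` as a cocharacter of `T̂`) and the
  Buzzard–Gee element `cGroupElt D = (2ρ)(-1) ∈ Ĝ` (Buzzard–Gee 2014, §5.3, Prop. 5.3.2 ff.),
  with theorems `cGroupElt_sq` (proved), `cGroupElt_mem_center`, `galAct_cGroupElt` (named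
  facts, D-0014; BG 2014 §5.3) and `cGroupElt_mem_centerFixed` (reusing G19's
  `LGroupData.centerFixed`);
* `rootSubgroupDual D i` (the root subgroup `U_{α_i^∨} ≤ Ĝ`), `simpleReflectionElt D i`;
* `IsStandardDualParabolic D Q` (`B̂ ≤ Q ≤ Ĝ` parabolic and `Γ_F`-stable, so that `Q ⋊ Γ_F` is a
  standard parabolic subgroup of `ᴸG`; Borel §3.3);
* `LParameter.IsDiscreteFor D φ` (no `Ĝ`-conjugate of `φ` has image in a proper standard
  parabolic of `ᴸG`) and `isDiscreteFor_iff_isDiscrete` comparing it with G19's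
  `LParameter.IsDiscrete` (`S_φ / Z(Ĝ)^Γ` finite; Kottwitz 1984 §10.3.1, Gross–Reeder 2010 §3.2).

## Mathlib

Everything about abstract (based) root data and their automorphisms is Mathlib's:
`RootPairing`, `RootPairing.flip`, `RootPairing.Base`, `RootPairing.Base.flip`,
`RootPairing.Base.IsPos`/`height`, `RootPairing.Aut` with `RootPairing.Equiv.coweightEquiv`,
`RootPairing.Equiv.indexHom`. Mathlib has no `2ρ` / Weyl vector for `RootPairing` (searched
`rho`, `positive roots`, `weylVector`), no dual group, L-group or C-group. Nothing here duplicates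
a Mathlib declaration. `RootPairing.Base.twoRho` is a deliberate dot-notation extension in
Mathlib's namespace; all other declarations are in `Literature.Automorphic` (dot-notation extensions of
G19's `LGroupData`, `LParameter`).

## Design notes

* (OUTLINE D1) `DualGroupStr` is a *hypothesis-structure*: nothing about existence/uniqueness of
  `(Ĝ, B̂, T̂, pinning)` is asserted here (that is Chevalley's theorem, lang.S13). The C-group of
  Buzzard–Gee is NOT built as a quotient (OUTLINE §4); it enters only through
  `cGroupElt D = (2ρ)(-1)`.
* Galois compatibility on characters is stated pointwise, `χ_{σ • y}(σ t) = χ_y(t)` for `t ∈ T̂`,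
  `y ∈ Y = X*(T̂)`, where `σ • y` is the *covariant* action `autCoweightAct` of
  `galRoot σ ∈ Aut P` on the coweight lattice `Y` of `P` (inverse transpose of the weight map;
  Mathlib's `coweightMap` is the transpose), as in Borel §2.1: the action of `Γ_F` on
  `Ψ₀(G)^∨` is the one induced from `μ_G` on `Ψ₀(G)`.
* `[torus_comm : IsMulCommutative ↥torus]` is an instance-binder field (OUTLINE §0 H2), so that
  `cocharacterLattice torus` makes sense in later fields and for every `D`.
* As in items I1–I2, the algebraic-group vocabulary is the `ℂ`-points one, faithful since `ℂ` is
  algebraically closed.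

## References

* A. Borel, *Automorphic L-functions*, Proc. Symp. Pure Math. 33.2 (Corvallis 1979), §§1–3, 8.
* K. Buzzard, T. Gee, *The conjectural connections between automorphic representations and Galois
  representations*, in *Automorphic forms and Galois representations* 1, LMS LNS 414 (2014), §5.3.
* R. Kottwitz, *Stable trace formula: cuspidal tempered terms*, Duke Math. J. 51 (1984), §§1, 10.
* B. Gross, M. Reeder, *Arithmetic invariants of discrete Langlands parameters*, Duke Math. J. 154
  (2010), §3.
* T. A. Springer, *Linear Algebraic Groups* (2nd ed., 1998), §§8.1, 9.6, 16.3.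
-/

noncomputable section

open Field
open scoped MatrixGroups

/-! ### `2ρ` of a based root pairing -/

namespace RootPairing.Base

variable {ι R M N : Type*} [CommRing R] [CharZero R] [AddCommGroup M] [Module R M]
  [AddCommGroup N] [Module R N] {P : RootPairing ι R M N}

open scoped Classical in
/-- The sum `2ρ = ∑_{α > 0} α ∈ M` of the roots of `P` that are positive with respect to the base
`b` (Mathlib `RootPairing.Base.IsPos`), for a finite root pairing (Bourbaki, *Lie* VI §1.10;
Springer 8.2.10 (half of it is `ρ`); Buzzard–Gee 2014 §5.3). Deliberate dot-notation extension
of Mathlib's `RootPairing.Base`. [cite: BuzzardGee2014, §5.3] -/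
def twoRho [Fintype ι] (b : P.Base) : M :=
  ∑ i ∈ Finset.univ.filter fun i => b.IsPos i, P.root i

end RootPairing.Base

namespace Literature.NumberTheory.Automorphic

/-! ### Covariant action of root-datum automorphisms on coweights -/

section CoweightAct

variable {ι R M N : Type*} [CommRing R] [AddCommGroup M] [Module R M] [AddCommGroup N]
  [Module R N] {P : RootPairing ι R M N}

/-- The *covariant* action of an automorphism `e` of a root pairing `P` on its coweight lattice
`N`: the inverse of Mathlib's (contravariant, transpose) `RootPairing.Equiv.coweightEquiv`, so
that `⟨e • x, autCoweightAct e y⟩ = ⟨x, y⟩` (SGA 3 XXI 6.1; Borel, Corvallis 1979, §2.1: an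
automorphism of `Ψ = (X, Φ, Y, Φ^∨)` acts on `Y` by the inverse transpose). [cite: Corvallis1979, §2.1: an automorphism of  Ψ = (X  Φ  Y] -/
def autCoweightAct (e : P.Aut) : N ≃ₗ[R] N :=
  (RootPairing.Equiv.coweightEquiv P P e).symm

/-- Unfolding `autCoweightAct`. [folklore] -/
lemma autCoweightAct_apply (e : P.Aut) (y : N) :
    autCoweightAct e y = (RootPairing.Equiv.coweightEquiv P P e).symm y := rfl

/-- The covariant coweight action preserves the perfect pairing: `⟨e • x, e • y⟩ = ⟨x, y⟩`
(SGA 3 XXI 6.1). [folklore] -/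
lemma toLinearMap_smul_autCoweightAct (e : P.Aut) (x : M) (y : N) :
    P.toLinearMap (e • x) (autCoweightAct e y) = P.toLinearMap x y := by
  obtain ⟨y', rfl⟩ := (RootPairing.Equiv.coweightEquiv P P e).surjective y
  rw [autCoweightAct_apply, LinearEquiv.symm_apply_apply, RootPairing.Equiv.coweightEquiv_apply]
  have h := RootPairing.Hom.weight_coweight_transpose_apply P P y' e.toHom
  have h' := LinearMap.congr_fun h x
  simp only [RootPairing.flip_toLinearMap, LinearMap.toLinearMap_toPerfPair,
    LinearMap.dualMap_apply, LinearMap.flip_apply] at h'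
  rw [← h']
  change P.toLinearMap (RootPairing.Equiv.weightEquiv P P e x) y' = _
  rw [RootPairing.Equiv.weightEquiv_apply]

/-- The covariant coweight action maps the coroot `α_i^∨` to `α_{e i}^∨` (companion of Mathlib's
`RootPairing.Equiv.root_indexEquiv_eq_smul`; SGA 3 XXI 6.1). This makes `galAct_char` and
`galAct_pinning` below consistent. [folklore] -/
lemma autCoweightAct_coroot (e : P.Aut) (i : ι) :
    autCoweightAct e (P.coroot i) = P.coroot (RootPairing.Equiv.indexHom P e i) := by
  rw [autCoweightAct_apply, LinearEquiv.symm_apply_eq, RootPairing.Equiv.coweightEquiv_apply,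
    RootPairing.Hom.coroot_coweightMap_apply]
  simp

end CoweightAct

/-! ### Dual group structures on an L-group datum -/

section DualGroup

variable {F : Type*} [Field F]
variable {ι X Y : Type*} [AddCommGroup X] [AddCommGroup Y]

/-- A **dual group structure** on the L-group datum `L` with respect to the based root datum
`(P, b)` (to be thought of as `Ψ₀(G) = (X*(T), Δ, X_*(T), Δ^∨)` of a connected reductive group
`G/F` with its `Γ_F`-action `μ_G`): the data exhibiting `Ĝ = L.dual ≤ GL_N(ℂ)` as "the" complex
dual group `ᴸG°` and `L.galAct` as an L-action (Borel, *Automorphic L-functions*, Corvallis 1979,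
§§1.2, 2.1–2.4; Springer 9.6.2, 16.3.1):

* `torus ≤ borel ≤ L.dual`: a maximal torus `T̂` and a Borel subgroup `B̂` of the connected
  reductive group `Ĝ`;
* `eX : X*(T̂) ≃ Y`, `eY : X_*(T̂) ≃ X` making Mathlib's dual based root datum `(P.flip, b.flip)`
  the based root datum of `(Ĝ, B̂, T̂)` (`IsBasedRootDatumOf`, item I2), and a `pinning`;
* `galRoot : Γ_F →* Aut(P, b)` with open kernel (the action `μ_G` of `Γ_F` on `Ψ₀(G)`, Borel
  §1.2), such that `L.galAct σ` is algebraic, preserves `T̂`, `B̂`, acts on `X*(T̂) = Y` through the covariant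
  coweight action of `galRoot σ` (`galAct_char`), and permutes the pinning accordingly
  (`galAct_pinning`), i.e. `L.galAct` is the L-action attached to `μ_G` and the pinning
  (Borel §2.1). [cite: Corvallis1979, §§1.2  2.1–2.4] -/
structure LGroupData.DualGroupStr (L : LGroupData F) (P : RootPairing ι ℤ X Y) (b : P.Base) where
  /-- The maximal torus `T̂ ≤ Ĝ`. -/
  torus : Subgroup (GL (Fin L.rank) ℂ)
  /-- The Borel subgroup `B̂ ≤ Ĝ`. -/
  borel : Subgroup (GL (Fin L.rank) ℂ)
  /-- `T̂` is commutative (instance-binder field, OUTLINE §0 H2). -/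
  [torus_comm : IsMulCommutative ↥torus]
  /-- `T̂ ≤ B̂`. -/
  torus_le_borel : torus ≤ borel
  /-- `B̂ ≤ Ĝ`. -/
  borel_le : borel ≤ L.dual
  /-- `Ĝ` is connected reductive (Borel §2.1). -/
  isConnectedReductive : IsConnectedReductive L.dual
  /-- `T̂` is a maximal torus of `Ĝ`. -/
  isMaximalTorus : IsMaximalTorusIn torus L.dual
  /-- `X*(T̂) ≃ Y = X_*(T)` (duality swaps characters and cocharacters; Borel §2.1). -/
  eX : Additive ↥(characterLattice torus) ≃+ Y
  /-- `X_*(T̂) ≃ X = X*(T)`. -/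
  eY : Additive ↥(cocharacterLattice torus) ≃+ X
  /-- `(P.flip, b.flip) = Ψ₀(G)^∨` is the based root datum of `(Ĝ, B̂, T̂)` (Borel §2.1). -/
  isBased : IsBasedRootDatumOf L.dual torus borel P.flip b.flip eX eY
  /-- A pinning (splitting) of `(Ĝ, B̂, T̂)` (Borel §§1.2, 2.1). -/
  pinning : Pinning L.dual torus (torus_le_borel.trans borel_le) P.flip b.flip eX
  /-- The action `μ_G` of `Γ_F` on the based root datum `(P, b)` (Borel §1.2). -/
  galRoot : absoluteGaloisGroup F →* ↥(basedAutGroup P b)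
  /-- `μ_G` factors through a finite Galois group (Borel §1.2). -/
  isOpen_ker_galRoot : IsOpen (galRoot.ker : Set (absoluteGaloisGroup F))
  /-- `Γ_F` preserves `T̂`. -/
  galAct_torus : ∀ (σ : absoluteGaloisGroup F) (t : ↥L.dual),
    (t : GL (Fin L.rank) ℂ) ∈ torus → ((L.galAct σ t : ↥L.dual) : GL (Fin L.rank) ℂ) ∈ torus
  /-- `Γ_F` preserves `B̂`. -/
  galAct_borel : ∀ (σ : absoluteGaloisGroup F) (g : ↥L.dual),
    (g : GL (Fin L.rank) ℂ) ∈ borel → ((L.galAct σ g : ↥L.dual) : GL (Fin L.rank) ℂ) ∈ borel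
  /-- `Γ_F` acts on `Ĝ` by *algebraic* automorphisms (Borel §2.1: the L-action is by
  automorphisms of the algebraic group `ᴸG°`). -/
  isAlgebraic_galAct : ∀ σ : absoluteGaloisGroup F,
    MonoidHom.IsAlgebraicGL (L.dual.subtype.comp (L.galAct σ).toMonoidHom)
  /-- On `X*(T̂) = Y` the Galois action is `μ_G`: `χ_{σ • y} (σ t) = χ_y (t)` (Borel §2.1). -/
  galAct_char : ∀ (σ : absoluteGaloisGroup F) (y : Y) (t : ↥L.dual)
    (ht : (t : GL (Fin L.rank) ℂ) ∈ torus),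
    charOfWeight eX (autCoweightAct (galRoot σ : P.Aut) y)
        ⟨((L.galAct σ t : ↥L.dual) : GL (Fin L.rank) ℂ), galAct_torus σ t ht⟩ =
      charOfWeight eX y ⟨(t : GL (Fin L.rank) ℂ), ht⟩
  /-- `Γ_F` permutes the pinning through `μ_G`: `σ (u_i (x)) = u_{σ i} (x)` (Borel §2.1). -/
  galAct_pinning : ∀ (σ : absoluteGaloisGroup F) (i : ↥b.flip.support) (x : Multiplicative ℂ),
    L.galAct σ (pinning.rootHom i x) =
      pinning.rootHom ⟨RootPairing.Equiv.indexHom P (galRoot σ : P.Aut) i,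
        ((galRoot σ).2 (i : ι)).mpr i.2⟩ x

attribute [instance] Literature.NumberTheory.Automorphic.LGroupData.DualGroupStr.torus_comm

namespace LGroupData.DualGroupStr

variable {L : LGroupData F} {P : RootPairing ι ℤ X Y} {b : P.Base}
variable (D : L.DualGroupStr P b)

/-- `T̂ ≤ Ĝ`. [folklore] -/
lemma torus_le : D.torus ≤ L.dual := D.torus_le_borel.trans D.borel_le

/-- `B̂` is a Borel subgroup of `Ĝ` (from `isBased`; Borel §2.1). [folklore] -/
lemma isBorelIn_borel : IsBorelIn D.borel L.dual := D.isBased.isBorelIn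

/-- The dual group structure `D` is *split*: `Γ_F` acts trivially on the based root datum
`(P, b)`, i.e. `μ_G = 1` — the case of `G/F` split, or an inner form of a split group, in which
`ᴸG = Ĝ × Γ_F` may be used (Borel, Corvallis 1979, §§1.2, 2.4; Getz–Hahn, GTM 300 (2024),
§7.3, p. 133, and §12.2, p. 234: "When `G` is split, the L-group is a direct product").

This is a CONDITION on `D` — a parametrised predicate, the root-datum analogue of
`LGroupData.IsSplit`, and the hypothesis of `IsSplitDual.isSplit` below — not a claim: it fails
whenever `μ_G ≠ 1`, e.g. for quasi-split unitary groups or `Res_{E/F} GL_n` with `E ≠ F`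
(Getz–Hahn §7.3, p. 134, (7.10) ff.), and `exists_dualGroupStr` (`ReductiveDual.lean`) posits
dual group structures with any prescribed open-kernel `galRoot`. The binder `D` is therefore
explicit (same name, same body as before): `∀ D, D.IsSplitDual` is false and there is no
`IsSplitDual_holds`. See `isSplitDual_iff`, `isSplitDual_of_subsingleton`. [folklore] -/
def IsSplitDual (D : L.DualGroupStr P b) : Prop := D.galRoot = 1

/-- `D` is split iff every `σ ∈ Γ_F` acts as the identity of the based root datum `(P, b)`
(unfolding of `IsSplitDual`). [folklore] -/
lemma isSplitDual_iff : D.IsSplitDual ↔ ∀ σ : absoluteGaloisGroup F, D.galRoot σ = 1 :=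
  MonoidHom.ext_iff

/-- When the based root datum `(P, b)` has no non-trivial based automorphism (`Aut(P, b)`
trivial, i.e. no symmetries of the based root datum), every dual group structure over it is
split: such `G` have no outer forms (Borel, Corvallis 1979, §1.2: the `F`-forms with given
`Ψ₀(G)` are governed by `μ_G : Γ_F → Aut Ψ₀(G)`). [folklore] -/
lemma isSplitDual_of_subsingleton [Subsingleton ↥(basedAutGroup P b)] : D.IsSplitDual :=
  MonoidHom.ext fun _ => Subsingleton.elim _ _

/-- If `Γ_F` acts trivially on the based root datum then it acts trivially on `Ĝ`: an
automorphism of the connected reductive group `Ĝ` fixing `T̂` pointwise and a pinning is the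
identity (Springer 8.1.5, 9.6.2; SGA 3 XXIII 5; Borel §2.1). Named fact (D-0014).
[cite: SpringerLAG1998, 9.6.2] -/
def IsSplitDual.isSplit : Prop := D.IsSplitDual → L.IsSplit

/-! ### Root subgroups and simple reflections of `Ĝ` -/

/-- The root subgroup `U_{α^∨_i} ≤ Ĝ` of the root `α_i^∨ = P.flip.root i` of `(Ĝ, T̂)`
(Springer 8.1.1; item I2 `rootSubgroup`). [folklore] -/
def rootSubgroupDual (i : ι) : Subgroup (GL (Fin L.rank) ℂ) :=
  rootSubgroup L.dual D.torus (charOfWeight D.eX (P.flip.root i))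

/-- A representative `n_i ∈ N_Ĝ(T̂)` of the reflection `s_i` of `(Ĝ, T̂)` in the root
`α_i^∨`: the image of the Weyl element `S = [[0, -1], [1, 0]]` of `SL₂` (Mathlib `ModularGroup.S`,
base-changed to `ℂ` by `Matrix.SpecialLinearGroup.map`) under an algebraic `φ_i : SL₂ → Ĝ`
attached to the pair `(α_i^∨, α_i)` by `IsRootDatumOf.exists_sl2Hom` (Springer 8.1.4 (i)).
Depends on the choice of `φ_i` (unique up to `T̂`-conjugacy); no junk value. [folklore] -/
def simpleReflectionElt (i : ι) : ↥L.dual :=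
  (D.isBased.isRootDatumOf.exists_sl2Hom i).choose
    (Matrix.SpecialLinearGroup.map (Int.castRingHom ℂ) ModularGroup.S)

/-! ### The Buzzard–Gee element `(2ρ)(-1)` -/

variable [Fintype ι]

/-- The sum of the `b`-positive roots `2ρ ∈ X = X*(T) = X_*(T̂)` viewed as a cocharacter
`𝔾ₘ → T̂` of the dual torus via `eY` (Buzzard–Gee 2014 §5.3; item I2 `cocharOfCoweight`). [cite: BuzzardGee2014, §5.3] -/
def twoRhoCochar : ℂˣ →* ↥D.torus :=
  cocharOfCoweight D.eY b.twoRho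

/-- The **Buzzard–Gee element** `ε = (2ρ)(-1) ∈ T̂ ≤ Ĝ`: the cocharacter `2ρ` of `T̂` (sum of the
positive roots of `G`) evaluated at `-1`. It is central of order `≤ 2` and Galois-fixed, and the
C-group is `(Ĝ ⋊ Γ_F) × 𝔾ₘ` modulo `(ε, -1)` (Buzzard–Gee 2014, §5.3, Prop. 5.3.3; not built
here, OUTLINE §4). [cite: BuzzardGee2014, §5.3  Prop. 5.3.3] -/
def cGroupElt : ↥L.dual :=
  Subgroup.inclusion D.torus_le (D.twoRhoCochar (-1))

/-- `ε² = 1` (Buzzard–Gee 2014 §5.3: `ε = (2ρ)(-1)` and `(-1)² = 1`). [cite: BuzzardGee2014, §5.3:  ε = (2ρ] -/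
theorem cGroupElt_sq : D.cGroupElt ^ 2 = 1 := by
  have h : ((-1 : ℂˣ)) ^ 2 = 1 := by norm_num
  simp only [cGroupElt, ← map_pow, h, map_one]

/-- `ε = (2ρ)(-1)` is central in `Ĝ`: `⟨2ρ, α^∨⟩ = 2 ∈ 2ℤ` for every simple coroot `α^∨` of `G`,
i.e. every simple root of `Ĝ`, so `α̂(ε) = 1` for all roots `α̂` of `(Ĝ, T̂)` and `ε ∈ Z(Ĝ)`
(Buzzard–Gee 2014, §5.3, proof of Prop. 5.3.3; Bourbaki *Lie* VI §1.10 Prop. 29). Named fact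
(D-0014). [cite: BuzzardGee2014, §5.3  proof of Prop. 5.3.3] -/
def cGroupElt_mem_center : Prop := D.cGroupElt ∈ Subgroup.center ↥L.dual

/-- `ε = (2ρ)(-1)` is fixed by `Γ_F`: the Galois action is based, hence permutes the positive
roots and fixes `2ρ` (Buzzard–Gee 2014, §5.3). Named fact (D-0014). [cite: BuzzardGee2014, §5.3] -/
def galAct_cGroupElt : Prop := ∀ σ : absoluteGaloisGroup F, L.galAct σ D.cGroupElt = D.cGroupElt

/-- `ε ∈ Z(Ĝ)^Γ` (G19 `LGroupData.centerFixed`; Buzzard–Gee 2014 §5.3), from the named facts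
`cGroupElt_mem_center` and `galAct_cGroupElt` (threaded as hypotheses, D-0014). [cite: BuzzardGee2014, §5.3] -/
theorem cGroupElt_mem_centerFixed (hc : D.cGroupElt_mem_center) (hg : D.galAct_cGroupElt) :
    D.cGroupElt ∈ L.centerFixed :=
  ⟨hc, hg⟩

end LGroupData.DualGroupStr

/-! ### Standard parabolic subgroups of `ᴸG` and discrete parameters -/

namespace LGroupData.DualGroupStr

variable {L : LGroupData F} {P : RootPairing ι ℤ X Y} {b : P.Base} (D : L.DualGroupStr P b)

/-- `Q` is a *standard parabolic subgroup of `Ĝ` defining a standard parabolic of `ᴸG`*: a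
parabolic subgroup of `Ĝ` containing `B̂` and stable under `Γ_F`, so that `ᴸQ = Q ⋊ Γ_F` is a
standard parabolic subgroup of `ᴸG = Ĝ ⋊ Γ_F`; every parabolic subgroup of `ᴸG` is
`Ĝ`-conjugate to exactly one such (Borel, Corvallis 1979, §§3.3–3.4). [cite: Corvallis1979, §§3.3–3.4] -/
def IsStandardDualParabolic (Q : Subgroup (GL (Fin L.rank) ℂ)) : Prop :=
  D.borel ≤ Q ∧ IsParabolicIn Q L.dual ∧
    ∀ (σ : absoluteGaloisGroup F) (g : ↥L.dual), (g : GL (Fin L.rank) ℂ) ∈ Q →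
      ((L.galAct σ g : ↥L.dual) : GL (Fin L.rank) ℂ) ∈ Q

/-- `Ĝ` itself is a standard parabolic (Borel §3.3). [folklore] -/
theorem isStandardDualParabolic_dual : D.IsStandardDualParabolic L.dual := by
  refine ⟨D.borel_le, ⟨le_rfl, D.isConnectedReductive.1.1, D.borel, D.isBorelIn_borel,
    D.borel_le⟩, fun σ g _ => (L.galAct σ g).2⟩

end LGroupData.DualGroupStr

end DualGroup

section Discrete

variable {F : Type*} [Field F] [ValuativeRel F] [TopologicalSpace F] [IsNonarchimedeanLocalField F]
/-! `LParameter.conj` / `LParameter.IsDiscrete` need continuity of `W_F → Γ_F`, the named fact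
`WeilGroup.continuous_toAbsGalois F` (D-0014), threaded as a `Fact` instance hypothesis exactly as
in `Literature.NumberTheory.Automorphic.LParameter`. -/
variable [Fact (GaloisRepresentations.WeilGroup.continuous_toAbsGalois F)]
variable {ι X Y : Type*} [AddCommGroup X] [AddCommGroup Y]
variable {L : LGroupData F} {P : RootPairing ι ℤ X Y} {b : P.Base}

/-- An L-parameter `φ` is *discrete relative to the dual group structure `D`* if no
`Ĝ`-conjugate of `φ` has image `φ(W_F × SL₂(ℂ))` contained in a proper standard parabolic
subgroup `Q ⋊ Γ_F` of `ᴸG` (`IsStandardDualParabolic`), i.e. the image of `φ` lies in no proper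
parabolic subgroup of `ᴸG` (Borel §3.3; Kottwitz 1984 §10.3; Gross–Reeder 2010 §3.2;
Kaletha 2016 §5.1). [cite: Kottwitz1984, §10.3] -/
def LParameter.IsDiscreteFor (D : L.DualGroupStr P b) (φ : LParameter L) : Prop :=
  ∀ Q : Subgroup (GL (Fin L.rank) ℂ), D.IsStandardDualParabolic Q → Q ≠ L.dual →
    ∀ g : ↥L.dual, ¬ ((∀ w : GaloisRepresentations.WeilGroup F, (((φ.conj g).φ w).left : GL (Fin L.rank) ℂ) ∈ Q) ∧
      ∀ s : SL(2, ℂ), (((φ.conj g).θ s : ↥L.dual) : GL (Fin L.rank) ℂ) ∈ Q)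

/-- The two notions of discreteness agree: the image of `φ` lies in no proper parabolic subgroup
of `ᴸG` iff `S_φ / Z(Ĝ)^Γ` is finite (G19 `LParameter.IsDiscrete`) (Kottwitz, Duke Math. J. 51
(1984), Lemma 10.3.1; Gross–Reeder, Duke Math. J. 154 (2010), §3.2). Named fact (D-0014).
[cite: Kottwitz1984, Lemma 10.3.1] -/
def LParameter.isDiscreteFor_iff_isDiscrete (D : L.DualGroupStr P b) (φ : LParameter L) : Prop :=
  φ.IsDiscreteFor D ↔ φ.IsDiscrete

end Discrete

end Literature.NumberTheory.Automorphic
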